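import Summits.NavierStokesRegularity.NavierStokesRegularity.Theorems.CertifiedBlowupRefutations

/-!
# Route `CertifiedBlowup` — item `stmt-NavierStokesRegularity-0270` (`certifiedBlowup_certificate`): typing audit of the certificate item

The support item `stmt-NavierStokesRegularity-0270` is filed informally as
"`∃ d : Literature.NS.BlowupProfileData, Literature.NS.BlowupProfileConditions d`" (a Chen–Hou-type
certificate, to be discharged by a sound interval-arithmetic verifier). The definition that landed,
`Literature.NS.BlowupProfileConditions (d) (F : Literature.NS.StabilityFrame d) : Prop`
(`Theorems/CertifiedBlowupConditions.lean`), takes the analytic frame `F` as an explicit second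
argument, so the informal statement is ill-typed and has exactly two frame-quantified closures:

* `∃ d F, BlowupProfileConditions d F` — **true with no analytic content**
  (`Literature.NS.exists_blowupProfileConditions_junk`, refuter audit, in tree);
* `∃ d, ∀ F, BlowupProfileConditions d F` — **false for every datum** (this file,
  `exists_frame_not_blowupProfileConditions`: the frame `X = ℝ`, `residual = |ε| + 1` violates the
  residual bound (i) whatever the rational constants of `d` are).

`certifiedBlowup_certificate_frame_dichotomy` records both facts in one statement. Consequence for the
route: no frame-quantified Lean statement of item 0270 is meaningful; an honest typing is
`∃ d, d.IsWellFormed ∧ BlowupProfileConditions d (nsFrame d)` and waits for the canonical-frame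
definition (`nsFrame d`: rescaled axisymmetric Navier–Stokes operator in similarity variables acting
on the Chebyshev reconstruction of `d`, Chen–Hou weights), which is not yet a definition item.
-/

-- single-conjunct summit: `Summit.<Summit>.<Problem>` repeats the name by convention (D-0017)
set_option linter.dupNamespace false

namespace Summit.NavierStokesRegularity.NavierStokesRegularity.Theorems

open Literature.NS

/-- **Some frame always violates the package.** For every datum `d` the one-dimensional frame
`X = ℝ`, `reconstruct ≡ 0`, `residual = |ε| + 1`, `linForm ≡ 0`, `nonlinForms = []` fails the
residual bound (i) `‖residual‖ ≤ ε` of `BlowupProfileConditions d F`, since `|ε| + 1 > ε`.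
Typing audit for stmt-NavierStokesRegularity-0270. [folklore] -/
theorem exists_frame_not_blowupProfileConditions (d : BlowupProfileData) :
    ∃ F : StabilityFrame d, ¬ BlowupProfileConditions d F := by
  refine ⟨{ X := ℝ, reconstruct := fun _ => 0, residual := |(d.residualBound : ℝ)| + 1,
            linForm := fun _ => 0, nonlinForms := [] }, fun h => ?_⟩
  have h1 : ‖(|(d.residualBound : ℝ)| + 1 : ℝ)‖ ≤ (d.residualBound : ℝ) := h.residual_le
  rw [Real.norm_eq_abs, abs_of_pos (by positivity)] at h1
  linarith [le_abs_self (d.residualBound : ℝ)]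

/-- **The universally frame-quantified typing of the certificate item is false**: no datum `d`
satisfies `BlowupProfileConditions d F` for all frames `F`. Typing audit for
stmt-NavierStokesRegularity-0270. [folklore] -/
theorem not_exists_forall_frame_blowupProfileConditions :
    ¬ ∃ d : BlowupProfileData, ∀ F : StabilityFrame d, BlowupProfileConditions d F := by
  rintro ⟨d, hd⟩
  obtain ⟨F, hF⟩ := exists_frame_not_blowupProfileConditions d
  exact hF (hd F)

/-- **Frame dichotomy for the certificate item** (stmt-NavierStokesRegularity-0270,
`certifiedBlowup_certificate`): of the two frame-quantified Lean closures of the informal statement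
"`∃ d, BlowupProfileConditions d`", the existential one holds outright (junk frame on the zero /
one-dimensional energy space, `Literature.NS.exists_blowupProfileConditions_junk`) and the universal
one fails outright (`not_exists_forall_frame_blowupProfileConditions`). Neither carries analytic
content; the item needs the canonical frame `nsFrame d` to be stated. [folklore] -/
theorem certifiedBlowup_certificate_frame_dichotomy :
    (∃ (d : BlowupProfileData) (F : StabilityFrame d), BlowupProfileConditions d F) ∧
      ¬ ∃ d : BlowupProfileData, ∀ F : StabilityFrame d, BlowupProfileConditions d F := by
  refine ⟨?_, not_exists_forall_frame_blowupProfileConditions⟩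
  obtain ⟨d, -, -, -, -, -, F, hF⟩ := exists_blowupProfileConditions_junk
  exact ⟨d, F, hF⟩

end Summit.NavierStokesRegularity.NavierStokesRegularity.Theorems
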